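import Literature.AlgebraicGeometry.ShimuraVarieties.HermitianTransposeCongruence
import Literature.AlgebraicGeometry.Motives.ConjugatePointsHomeomorph
import Literature.AlgebraicGeometry.Motives.BaseChangeProofs
import Mathlib.Analysis.Calculus.FDeriv.Star
import HarnessLib

/-!
# The complex-conjugate of a compact arithmetic ball quotient is a compact arithmetic ball quotient

Let `D : UnitaryBallUniformisationDatum p X` exhibit the smooth projective complex variety `X` as
`Γ \ 𝔹ᵖ` (Bergeron–Millson–Moeglin, Acta Math. 216 (2016), Introduction §1.1, Part 2 §§1.1–1.4:
CM field `E ⊆ ℂ`, hermitian Gram matrix `H` on `V = E^{p+1}` of signature `(p,1)` at the inclusion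
`τ₁`, torsion-free congruence subgroup `Γ ⊆ U(V)(F)`, holomorphic uniformisation
`unif : negCone H^{τ₁} → X(ℂ)` with fibres the `Γ·ℂˣ`-orbits).  The COMPLEX-CONJUGATE variety
`X̄ := X^c = X ×_{Spec ℂ, Spec c} Spec ℂ` (`Motives.conjugateVariety conjAut X`, Deligne's `σX` for
`σ = c`; Serre, GAGA §2: `X̄(ℂ)` is `X(ℂ)` with the conjugate complex structure) is again such a
quotient, for the CONJUGATE hermitian space: this file constructs

* `UnitaryBallUniformisationDatum.conjugate D : UnitaryBallUniformisationDatum p (conjugateVariety conjAut X)`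

with the SAME CM field `E ⊆ ℂ` (so the same `τ₁`), Gram matrix `Hᵀ = c(H)` (the form
`v ↦ \overline{h(v̄, v̄)}`, hermitian, anisotropic, signature `(p,1)` at `τ₁` via `T ↦ T̄`,
positive definite at the other places), arithmetic group `c(Γ)` (entrywise CM conjugation: again a
torsion-free congruence subgroup, now of `U(Hᵀ)`), and uniformisation `v ↦ \overline{unif(v̄)}`, i.e.
`toConjugate ∘ unif ∘ star` on `negCone (H^{τ₁})ᵀ = star ⁻¹' negCone H^{τ₁}` — continuous, open, onto,
with fibres the `c(Γ)·ℂˣ`-orbits (`c(γ)^{τ₁} · v = λ̄ · w ↔ γ^{τ₁} · v̄ = λ · w̄`), and HOLOMORPHIC: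
a regular function `f'` on an affine open of `X̄` reads on points as `conj ∘ f ∘ (·)̄` for a regular
function `f` on the corresponding affine open of `X` (`AlgPoints.evalOrZero_toConjugate`, the section
dictionary of `Motives/ConjugatePointsHomeomorph.lean`), so `f' ∘ unif' = conj ∘ (f ∘ unif) ∘ star` is
holomorphic because `f ∘ unif` is (Mathlib `DifferentiableAt.star_star`).  `X̄` is smooth projective of
dimension `p` by `IsSmoothProjective.conjugateVariety_holds`.

Read-outs for consumers (pinning of levels along `ι₁`): `conjugate_Hℂ : D.conjugate.Hℂ = D.Hℂᵀ`,
`conjugate_Hℂ_eq_map_conj : D.conjugate.Hℂ = D.Hℂ.map conj`, and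
`conjugate_Γ_map_τ₁ : D.conjugate.Γ^{τ₁} = conj (D.Γ^{τ₁})` (images in `GL_{p+1}(ℂ)`).

This is the «conjugation» half of the transport of ball-quotient presentations between a hermitian
space and its complex conjugate (Shimura, *Introduction to the arithmetic theory of automorphic
functions*, §7; Milne, *Introduction to Shimura varieties*, §12, conjugates of Shimura varieties);
the E-linear re-framing `c(H) ≅ H` (any two diagonalisations) is a separate, purely algebraic step.
Everything here is a construction or a theorem; nothing is posited.

## References

* [BergeronMillsonMoeglin2016Balls] N. Bergeron, J. Millson, C. Moeglin, Acta Math. 216 (2016), Introduction §1.1, Part 2 §§1.1–1.4.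
* [SerreGAGA1956] J.-P. Serre, *Géométrie algébrique et géométrie analytique*, Ann. Inst. Fourier 6 (1956), §2.
* [Milne2005ShimuraVarieties] J. S. Milne, *Introduction to Shimura varieties* (2005), §12.
-/

noncomputable section

open Matrix NumberField Topology CategoryTheory AlgebraicGeometry
open scoped ComplexOrder ComplexConjugate

namespace Literature.AlgebraicGeometry.ShimuraVarieties

open Literature.AlgebraicGeometry.Motives
open Literature.AlgebraicGeometry.Motives.AlgPoints

/-! ### Complex conjugation as a ring automorphism of `ℂ` -/

/-- Complex conjugation as a ring AUTOMORPHISM `ℂ ≃+* ℂ` (Mathlib's `starRingAut`): the `σ` at which the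
complex-conjugate variety `X̄ = X^σ` is formed (`Motives.conjugateVariety conjAut X`). [folklore] -/
abbrev conjAut : ℂ ≃+* ℂ := starRingAut

/-- `conjAut z = conj z`. [folklore] -/
@[simp] private theorem conjAut_apply (z : ℂ) : conjAut z = conj z := rfl

/-- `conjAut` is continuous. [folklore] -/
private theorem continuous_conjAut : Continuous conjAut := Complex.continuous_conj

/-! ### The conjugate datum -/

namespace UnitaryBallUniformisationDatum

variable {p : ℕ} {X : SchemeOver ℂ} (D : UnitaryBallUniformisationDatum p X)

/-- The CM conjugation of `E` is an involution. [cite: BergeronMillsonMoeglin2016Balls, Part 2 §1.1] -/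
theorem conjRingHom_conjRingHom (x : D.E) : conjRingHom D.E (conjRingHom D.E x) = x := by
  apply Subtype.val_injective
  change D.E.subtype (conjRingHom D.E (conjRingHom D.E x)) = D.E.subtype x
  rw [embedding_conjRingHom, embedding_conjRingHom, Complex.conj_conj]

/-- `τ₁ ∘ c = conj ∘ τ₁` as ring homomorphisms `E → ℂ`. [cite: BergeronMillsonMoeglin2016Balls, Part 2 §1.1] -/
theorem τ₁_comp_conjRingHom : D.τ₁.comp (conjRingHom D.E) = (starRingEnd ℂ).comp D.τ₁ :=
  RingHom.ext fun x => embedding_conjRingHom D.E D.τ₁ x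

/-- `(H^{τ₁})ᵀ = \overline{H^{τ₁}}` (the complex Gram matrix is hermitian). [cite: BergeronMillsonMoeglin2016Balls, Part 2 §1.1] -/
theorem Hℂ_transpose_eq_map_conj : D.Hℂᵀ = D.Hℂ.map (starRingEnd ℂ) :=
  IsHermitian.transpose_eq_map_conj D.isHermitian_Hℂ

/-- **The action of a conjugated group element is the conjugate action**:
`(c γ)^{τ₁} · v = \overline{γ^{τ₁} · v̄}`. [cite: BergeronMillsonMoeglin2016Balls, Part 2 §1.2] -/
theorem map_τ₁_conj_mulVec (γ : GL (Fin (p + 1)) D.E) (v : Fin (p + 1) → ℂ) :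
    (((Matrix.GeneralLinearGroup.map (conjRingHom D.E) γ : GL (Fin (p + 1)) D.E) :
        Matrix (Fin (p + 1)) (Fin (p + 1)) D.E).map D.τ₁) *ᵥ v =
      star ((((γ : Matrix (Fin (p + 1)) (Fin (p + 1)) D.E)).map D.τ₁) *ᵥ star v) := by
  rw [show ((Matrix.GeneralLinearGroup.map (conjRingHom D.E) γ : GL (Fin (p + 1)) D.E) :
      Matrix (Fin (p + 1)) (Fin (p + 1)) D.E) = (γ : Matrix (Fin (p + 1)) (Fin (p + 1)) D.E).map (conjRingHom D.E)
      from rfl, Matrix.map_map, ← RingHom.coe_comp, τ₁_comp_conjRingHom,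
    RingHom.coe_comp, ← Matrix.map_map, map_conj_mulVec]

/-- The uniformisation of the conjugate variety: `v ↦ \overline{unif(v̄)}`, i.e.
`toConjugate ∘ unif ∘ star`. [cite: SerreGAGA1956, §2] -/
def conjUnif (v : Fin (p + 1) → ℂ) : ComplexPoints (conjugateVariety conjAut X) :=
  toConjugate conjAut X (D.unif (star v))

/-- `conjUnif` unfolds. [folklore] -/
private theorem conjUnif_apply (v : Fin (p + 1) → ℂ) : D.conjUnif v = toConjugate conjAut X (D.unif (star v)) := rfl

/-- The cone of the conjugate datum is the conjugate cone: `v ∈ negCone (Hℂᵀ) ↔ v̄ ∈ negCone Hℂ`. [cite: BergeronMillsonMoeglin2016Balls, Part 2 §1.3] -/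
theorem mem_cone_transpose_iff (v : Fin (p + 1) → ℂ) : v ∈ negCone D.Hℂᵀ ↔ star v ∈ D.cone :=
  mem_negCone_transpose_iff

/-- `star` restricts to a homeomorphism `negCone Hℂᵀ ≃ₜ negCone Hℂ`. [folklore] -/
def coneStarHomeomorph : negCone D.Hℂᵀ ≃ₜ D.cone :=
  Homeomorph.sets (Homeomorph.mk ⟨star, star, star_star, star_star⟩ continuous_star continuous_star)
    (Set.ext fun v => D.mem_cone_transpose_iff v)

/-- The open set of the cone above an open `U ⊆ X` is open in `ℂ^{p+1}`. [cite: BergeronMillsonMoeglin2016Balls, Introduction §1.1] -/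
theorem isOpen_cone_inter_preimage (U : X.left.Opens) :
    IsOpen (D.cone ∩ D.unif ⁻¹' {P | P.pt ∈ U}) :=
  D.continuousOn_unif.isOpen_inter_preimage (isOpen_negCone _) (isOpen_setOf_pt_mem U)

/-- **The complex-conjugate ball quotient.**  For `D : X(ℂ) ≅ Γ \ 𝔹(V)`, the conjugate variety
`X̄ = X^c` is `c(Γ) \ 𝔹(V̄)`: same CM field `E ⊆ ℂ`, Gram matrix `Hᵀ = c(H)`, group `c(Γ)`, uniformisation
`v ↦ \overline{unif(v̄)}`; holomorphy from the section dictionary of the conjugate variety and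
`DifferentiableAt.star_star`; smooth projectivity from `IsSmoothProjective.conjugateVariety_holds`.
[cite: SerreGAGA1956, §2] [cite: BergeronMillsonMoeglin2016Balls, Introduction §1.1 and Part 2 §§1.1–1.4] -/
def conjugate : UnitaryBallUniformisationDatum p (conjugateVariety conjAut X) where
  E := D.E
  H := D.Hᵀ
  conj_H_apply i j := by rw [transpose_apply, transpose_apply, D.conj_H_apply]
  anisotropic v hv := by
    rw [hermForm_transpose D.conjRingHom_conjRingHom] at hv
    have h0 := D.anisotropic _ hv
    funext i
    have hi := congrFun h0 i
    simp only [Function.comp_apply, Pi.zero_apply] at hi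
    rw [← D.conjRingHom_conjRingHom (v i), hi, map_zero, Pi.zero_apply]
  signature_τ₁ := by
    obtain ⟨T, hT⟩ := D.signature_τ₁
    rw [Matrix.transpose_map]
    exact exists_conjTranspose_mul_transpose_mul (signatureMatrix_transpose p) T hT
  posDef_of_ne τ hτ := by
    rw [Matrix.transpose_map]
    exact (D.posDef_of_ne τ hτ).transpose
  Γ := D.Γ.map (Matrix.GeneralLinearGroup.map (conjRingHom D.E))
  isCongruenceSubgroup := IsCongruenceSubgroup.map_transpose D.conjRingHom_conjRingHom D.isCongruenceSubgroup
  torsionFree := torsionFree_map D.conjRingHom_conjRingHom D.torsionFree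
  unif := D.conjUnif
  continuousOn_unif := by
    rw [Matrix.transpose_map]
    refine (continuous_toConjugate continuous_conjAut).comp_continuousOn
      (D.continuousOn_unif.comp continuous_star.continuousOn fun v hv => ?_)
    exact (D.mem_cone_transpose_iff v).1 hv
  isOpenMap_unif := by
    rw [Matrix.transpose_map]
    have h : (negCone D.Hℂᵀ).restrict D.conjUnif =
        toConjugate conjAut X ∘ D.cone.restrict D.unif ∘ D.coneStarHomeomorph := by
      funext v
      rfl
    rw [h]
    exact (conjugateHomeomorph conjAut X continuous_conjAut).isOpenMap.comp
      (D.isOpenMap_unif.comp D.coneStarHomeomorph.isOpenMap)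
  surjOn_unif := by
    rw [Matrix.transpose_map]
    intro y' _
    obtain ⟨v, hv, hvy⟩ := D.surjOn_unif (Set.mem_univ (ofConjugate conjAut X y'))
    refine ⟨star v, ?_, ?_⟩
    · exact (D.mem_cone_transpose_iff (star v)).2 (by rwa [star_star])
    · change toConjugate conjAut X (D.unif (star (star v))) = y'
      rw [star_star, hvy, toConjugate_ofConjugate]
  unif_eq_unif_iff := by
    rw [Matrix.transpose_map]
    intro v hv w hw
    rw [D.mem_cone_transpose_iff] at hv hw
    change toConjugate conjAut X (D.unif (star v)) = toConjugate conjAut X (D.unif (star w)) ↔ _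
    rw [(bijective_toConjugate (σ := conjAut) (Y := X)).1.eq_iff, D.unif_eq_unif_iff (star v) hv (star w) hw]
    constructor
    · rintro ⟨γ, hγ, c, hc, hγv⟩
      refine ⟨Matrix.GeneralLinearGroup.map (conjRingHom D.E) γ, Subgroup.mem_map_of_mem _ hγ, star c,
        star_ne_zero.2 hc, ?_⟩
      rw [map_τ₁_conj_mulVec, hγv, star_smul, star_star]
    · rintro ⟨_, ⟨γ, hγ, rfl⟩, c, hc, hγv⟩
      refine ⟨γ, hγ, star c, star_ne_zero.2 hc, ?_⟩
      rw [map_τ₁_conj_mulVec] at hγv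
      have h := congrArg star hγv
      rwa [star_star, star_smul] at h
  differentiableOn_unif U' s' := by
    rw [Matrix.transpose_map]
    -- the corresponding affine open of `X` and the pushed-forward section
    have hU : IsAffineOpen (invPreimage conjAut X (U' : (conjugateVariety conjAut X).left.Opens)) :=
      isAffineOpen_invPreimage U'.2
    have hg := D.differentiableOn_unif ⟨_, hU⟩
      ((inv (conjFst conjAut X)).app (U' : (conjugateVariety conjAut X).left.Opens) s')
    -- the function is `conj ∘ g ∘ star`
    have hfun : (fun v => evalOrZero (U' : (conjugateVariety conjAut X).left.Opens) s' (D.conjUnif v)) =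
        star ∘ (fun w => evalOrZero (invPreimage conjAut X (U' : (conjugateVariety conjAut X).left.Opens))
          ((inv (conjFst conjAut X)).app (U' : (conjugateVariety conjAut X).left.Opens) s') (D.unif w)) ∘ star := by
      funext v
      simp only [Function.comp_apply, conjUnif_apply, evalOrZero_toConjugate]
      rfl
    -- the set is `star ⁻¹'` of the corresponding set for `D`
    have hset : negCone D.Hℂᵀ ∩ D.conjUnif ⁻¹' {P | P.pt ∈ (U' : (conjugateVariety conjAut X).left.Opens)} =
        star ⁻¹' (D.cone ∩ D.unif ⁻¹'
          {P | P.pt ∈ invPreimage conjAut X (U' : (conjugateVariety conjAut X).left.Opens)}) := by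
      ext v
      simp only [Set.mem_inter_iff, Set.mem_preimage, Set.mem_setOf_eq, conjUnif_apply,
        pt_toConjugate_mem_iff', D.mem_cone_transpose_iff]
    rw [hfun, hset]
    intro v hv
    have hAt := (hg.differentiableAt ((D.isOpen_cone_inter_preimage _).mem_nhds hv)).star_star
    rw [star_star] at hAt
    exact hAt.differentiableWithinAt
  isSmoothProjective := IsSmoothProjective.conjugateVariety_holds conjAut D.isSmoothProjective

/-! ### Read-outs -/

/-- The conjugate datum has the same CM field `E ⊆ ℂ` (hence the same `τ₁`). [cite: BergeronMillsonMoeglin2016Balls, Part 2 §1.1] -/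
@[simp] theorem conjugate_E : D.conjugate.E = D.E := rfl

/-- The Gram matrix of the conjugate datum is `Hᵀ` (`= c(H)` entrywise, `conj_H_apply`). [cite: BergeronMillsonMoeglin2016Balls, Part 2 §1.1] -/
theorem conjugate_H : D.conjugate.H = D.Hᵀ := rfl

/-- **`Hℂ` of the conjugate datum is the transpose `(H^{τ₁})ᵀ`.** [cite: BergeronMillsonMoeglin2016Balls, Part 2 §1.1] -/
theorem conjugate_Hℂ : D.conjugate.Hℂ = D.Hℂᵀ := Matrix.transpose_map

/-- **`Hℂ` of the conjugate datum is the entrywise conjugate `\overline{H^{τ₁}}`.** [cite: BergeronMillsonMoeglin2016Balls, Part 2 §1.1] -/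
theorem conjugate_Hℂ_eq_map_conj : D.conjugate.Hℂ = D.Hℂ.map (starRingEnd ℂ) := by
  rw [conjugate_Hℂ, Hℂ_transpose_eq_map_conj]

/-- The arithmetic group of the conjugate datum is `c(Γ)`. [cite: BergeronMillsonMoeglin2016Balls, Part 2 §1.2] -/
theorem conjugate_Γ : D.conjugate.Γ = D.Γ.map (Matrix.GeneralLinearGroup.map (conjRingHom D.E)) := rfl

/-- **The complex image of the group of the conjugate datum is the conjugate of that of `D`:**
`c(Γ)^{τ₁} = \overline{Γ^{τ₁}}` in `GL_{p+1}(ℂ)`. [cite: BergeronMillsonMoeglin2016Balls, Part 2 §1.2] -/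
theorem conjugate_Γ_map_τ₁ :
    D.conjugate.Γ.map (Matrix.GeneralLinearGroup.map D.conjugate.τ₁) =
      (D.Γ.map (Matrix.GeneralLinearGroup.map D.τ₁)).map
        (Matrix.GeneralLinearGroup.map (starRingEnd ℂ)) := by
  show (D.Γ.map (Matrix.GeneralLinearGroup.map (conjRingHom D.E))).map (Matrix.GeneralLinearGroup.map D.τ₁) = _
  rw [Subgroup.map_map, Subgroup.map_map, ← Matrix.GeneralLinearGroup.map_comp,
    ← Matrix.GeneralLinearGroup.map_comp]
  exact congrArg (fun f => D.Γ.map (Matrix.GeneralLinearGroup.map f)) D.τ₁_comp_conjRingHom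

/-- The uniformisation of the conjugate datum is `v ↦ \overline{unif(v̄)}`. [cite: SerreGAGA1956, §2] -/
theorem conjugate_unif (v : Fin (p + 1) → ℂ) :
    D.conjugate.unif v = toConjugate conjAut X (D.unif (star v)) := rfl

/-- The cone of the conjugate datum is `star ⁻¹'` the cone of `D`. [cite: BergeronMillsonMoeglin2016Balls, Part 2 §1.3] -/
theorem mem_conjugate_cone_iff (v : Fin (p + 1) → ℂ) : v ∈ D.conjugate.cone ↔ star v ∈ D.cone := by
  rw [show D.conjugate.cone = negCone D.Hℂᵀ by rw [← conjugate_Hℂ]]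
  exact D.mem_cone_transpose_iff v

/-- Under the identification `X̄(ℂ) = X(ℂ)` (`ofConjugate`), the conjugate uniformisation at `v` is the
original uniformisation at `v̄`. [cite: SerreGAGA1956, §2] -/
theorem ofConjugate_conjugate_unif (v : Fin (p + 1) → ℂ) :
    ofConjugate conjAut X (D.conjugate.unif v) = D.unif (star v) := by
  rw [conjugate_unif, ofConjugate_toConjugate]

end UnitaryBallUniformisationDatum

end Literature.AlgebraicGeometry.ShimuraVarieties

end
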